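import Summits.NavierStokesRegularity.NavierStokesRegularity.Theses.CoriolisHead
import Summits.NavierStokesRegularity.NavierStokesRegularity.Theorems.CoriolisHeadCounterRotatingLiouvilleCalculus
import Summits.NavierStokesRegularity.NavierStokesRegularity.Theorems.SymmetryModuliCountAxisymEndLiouvilleStubAxisNormalForm
import Literature.Analysis.FluidPDE.IsometryInvariance
import Literature.Analysis.FluidPDE.HarmonicProbe
import Literature.Analysis.FluidPDE.LeraySelfSimilarCalculus
import Literature.Analysis.FluidPDE.NecasRuzickaSverakRRS
import HarnessLib

/-!
# Route CoriolisHead · crux `NoCoRotatingCore` (stmt-NavierStokesRegularity-22676) —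
# normal form of the rotated Leray profile system (scaling + axis)

Support file (`--supports stmt-NavierStokesRegularity-22676`; theorems only, no definitions, no named
facts).  The crux binders speak of a smooth bounded solution `(U, P)` of the rotated Leray profile
system with ARBITRARY viscosity `ν > 0`, similarity rate `a > 0` and skew frame rate `B`,

  `−νΔU + aU + a DU[y] + (BU − DU[By]) + DU[U] + ∇P = 0`, `div U = 0`.

This file reduces that system to Pineau–Vicol's normal form (arXiv:2607.09619, (1.8a)):

* `rotatedProfileSystem_dilate` — DILATION COVARIANCE: for `k, c > 0` the pair
  `Ū(z) = k U(cz)`, `P̄(z) = k² P(cz)` solves the system with `(ν', a', B') = (kν/c, kca, kc B)`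
  (every term of the new system at `z` is `k²c` times the old one at `y = cz`).
* `rotatedProfileSystem_normalise` — the choice `c = √(ν/(2a))`, `k = c/ν = 1/√(2aν)` gives
  `ν' = 1`, `a' = ½`, `B' = (2a)⁻¹ B`, with the dictionary `‖Ū(z)‖ = ‖U(cz)‖/√(2aν)` and
  `DŪ(z) = (2a)⁻¹ DU(cz)`.
* `rotatedProfileSystem_axisNormalForm` — AXIS NORMAL FORM at `ν = 1`, `a = ½`: conjugating by a
  linear isometry `L` with `L B' L⁻¹ = αJ` (`J = rotGen = e₃ × ·`; tree:
  `exists_conj_eq_smul_rotGen`; `α = 0`, `L = 1` when `B' = 0`) turns the system into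
  Pineau–Vicol's profile system `α(JV − DV[Jy]) + ½V + ½DV[y] − ΔV + DV[V] + ∇Q = 0` for
  `V = L ∘ Ū ∘ L⁻¹`, `Q = P̄ ∘ L⁻¹` (tree: `IsometryInvariance`), with `‖V(y)‖ = ‖Ū(L⁻¹y)‖` and
  `‖DŪ(x)‖ ≤ ‖DV(Lx)‖`.
* `exists_pvProfile_of_rotatedProfile` — the composite dictionary consumed by the uniform gradient
  bound (`CoriolisHeadNoCoRotatingCoreUniformGradient`) and the small-amplitude Liouville theorem
  (`CoriolisHeadNoCoRotatingCoreSmallAmplitude`): every smooth rotated profile `(U, P)` (any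
  `ν, a > 0`, any skew `B`) has a smooth Pineau–Vicol profile `(α, V, Q)` with
  `sup |V| ≤ sup |U| / √(2aν)` and `‖DU(y)‖ ≤ 2a ‖DV(z_y)‖` at a corresponding point.

HONEST FRAMING. Bookkeeping only; nothing here proves `NoCoRotatingCore`, `X`, or Navier–Stokes
regularity.

References: B. Pineau, V. Vicol, arXiv:2607.09619 (2026), (1.7)–(1.8) [PineauVicol2026];
T.-P. Tsai, ARMA 143 (1998), §3.3 (viscosity normalisation) [Tsai1998].
-/

noncomputable section

-- the summit and its single sub-problem share the name (CONVENTIONS §1), as in every Theorems file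
set_option linter.dupNamespace false

open Set Function
open scoped ContDiff Laplacian RealInnerProductSpace
open Literature.Analysis.FluidPDE
open Summit.NavierStokesRegularity.NavierStokesRegularity.Theorems.AxisymEndLiouville.AbsorbingAxisSwirlExtinction
  (exists_conj_eq_smul_rotGen)

namespace Summit.NavierStokesRegularity.NavierStokesRegularity.Theorems.CoriolisHead

/-! ### Dilation covariance -/

/-- **Dilation covariance of the rotated Leray profile system.** If `(U, P)` solves
`−νΔU + aU + a DU[y] + (BU − DU[By]) + DU[U] + ∇P = 0`, then for `c ≠ 0` and any `k`, the pair
`Ū(z) = k U(cz)`, `P̄(z) = k² P(cz)` solves the same system with viscosity `ν'`, rate `a'` and frame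
rate `(kc) B` whenever `ν' c = k ν` and `a' = k c a`: every term of the new system at `z` is `k²c`
times the corresponding term of the old one at `y = cz` (`ΔŪ(z) = kc² ΔU(y)`, `DŪ(z) = kc DU(y)`,
`∇P̄(z) = k²c ∇P(y)`). [cite: Tsai1998, §3.3 (p. 39), the case B = 0] -/
theorem rotatedProfileSystem_dilate {ν a ν' a' k c : ℝ} (hc : c ≠ 0) (hν' : ν' * c = k * ν)
    (ha' : a' = k * c * a) {B : (EuclideanSpace ℝ (Fin 3)) →L[ℝ] (EuclideanSpace ℝ (Fin 3))} {U : (EuclideanSpace ℝ (Fin 3)) → (EuclideanSpace ℝ (Fin 3))} {P : (EuclideanSpace ℝ (Fin 3)) → ℝ}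
    (heq : ∀ y, -(ν • (Δ U) y) + a • U y + a • fderiv ℝ U y y + (B (U y) - fderiv ℝ U y (B y))
      + convect U U y + gradient P y = 0) (z : (EuclideanSpace ℝ (Fin 3))) :
    -(ν' • (Δ (fun w => k • U (c • w))) z) + a' • (k • U (c • z))
      + a' • fderiv ℝ (fun w => k • U (c • w)) z z
      + (((k * c) • B) (k • U (c • z)) - fderiv ℝ (fun w => k • U (c • w)) z (((k * c) • B) z))
      + convect (fun w => k • U (c • w)) (fun w => k • U (c • w)) z
      + gradient (fun w => k ^ 2 * P (c • w)) z = 0 := by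
  set y : (EuclideanSpace ℝ (Fin 3)) := c • z with hy
  have hΔ : (Δ (fun w => k • U (c • w))) z = (k * c ^ 2) • (Δ U) y :=
    laplacian_const_smul_comp_smul U k hc z
  have hD : fderiv ℝ (fun w => k • U (c • w)) z = (k * c) • fderiv ℝ U y :=
    fderiv_const_smul_comp_smul' U k c z
  have hG : gradient (fun w => k ^ 2 * P (c • w)) z = (k ^ 2 * c) • gradient P y :=
    gradient_const_mul_comp_smul P _ c z
  -- the atoms: `DU(y) y = c • DU(y) z`, `B y = c • B z`
  have hz : z = c⁻¹ • y := by rw [hy, smul_smul, inv_mul_cancel₀ hc, one_smul]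
  have e1 : fderiv ℝ U y z = c⁻¹ • fderiv ℝ U y y := by
    rw [hz, ContinuousLinearMap.map_smul]
  have e2 : fderiv ℝ U y (B z) = c⁻¹ • fderiv ℝ U y (B y) := by
    rw [hz, ContinuousLinearMap.map_smul, ContinuousLinearMap.map_smul]
  have key := congrArg (fun v => (k ^ 2 * c) • v) (heq y)
  simp only [convect_apply, smul_add, smul_sub, smul_neg, smul_smul, smul_zero] at key
  simp only [convect_apply]
  rw [hΔ, hD, hG]
  simp only [smul_apply, ContinuousLinearMap.map_smul, smul_smul]
  rw [e1, e2, smul_smul, smul_smul]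
  -- scalar bookkeeping
  have h1 : ν' * (k * c ^ 2) = k ^ 2 * c * ν := by
    calc ν' * (k * c ^ 2) = (ν' * c) * (k * c) := by ring
      _ = (k * ν) * (k * c) := by rw [hν']
      _ = k ^ 2 * c * ν := by ring
  have h2 : a' * k = k ^ 2 * c * a := by rw [ha']; ring
  have h3 : a' * (k * c) * c⁻¹ = k ^ 2 * c * a := by
    rw [ha']; field_simp
  have h5 : k * c * (k * c) * c⁻¹ = k ^ 2 * c := by field_simp
  rw [h1, h2, h3, h5, ← hy]
  linear_combination (norm := module) key

/-- **Viscosity / rate normalisation.** For `ν, a > 0` put `c = √(ν/(2a))` and `k = c/ν`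
(`= 1/√(2aν)`). If `(U, P)` (`U ∈ C^∞`, `P ∈ C¹`, `div U = 0`, `B` skew) solves the rotated Leray
profile system with `(ν, a, B)`, then `Ū(z) = k U(cz)`, `P̄(z) = k² P(cz)` is a smooth
divergence-free solution of the system with `ν = 1`, `a = ½` and the skew frame rate `(2a)⁻¹ B`;
moreover `‖Ū(z)‖ = ‖U(cz)‖/√(2aν)`-type bookkeeping: `Ū(z) = (c/ν) U(cz)` with `(c/ν)² = (2aν)⁻¹`,
and `DŪ(z) = (2a)⁻¹ DU(cz)`. [cite: Tsai1998, §3.3 (p. 39), the case B = 0] -/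
theorem rotatedProfileSystem_normalise {ν a : ℝ} (hν : 0 < ν) (ha : 0 < a)
    {B : (EuclideanSpace ℝ (Fin 3)) →L[ℝ] (EuclideanSpace ℝ (Fin 3))} {U : (EuclideanSpace ℝ (Fin 3)) → (EuclideanSpace ℝ (Fin 3))} {P : (EuclideanSpace ℝ (Fin 3)) → ℝ}
    (hU : ContDiff ℝ ∞ U) (hP : ContDiff ℝ 1 P) (hB : ∀ x, ⟪B x, x⟫ = 0)
    (hdiv : VectorCalculus.IsDivFree U)
    (heq : ∀ y, -(ν • (Δ U) y) + a • U y + a • fderiv ℝ U y y + (B (U y) - fderiv ℝ U y (B y))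
      + convect U U y + gradient P y = 0) :
    ∃ c : ℝ, 0 < c ∧ (c / ν) ^ 2 = (2 * a * ν)⁻¹ ∧
      ContDiff ℝ ∞ (fun w => (c / ν) • U (c • w)) ∧
      ContDiff ℝ ∞ (fun w => (c / ν) ^ 2 * P (c • w)) ∧
      (∀ x, ⟪((2 * a)⁻¹ • B) x, x⟫ = 0) ∧
      VectorCalculus.IsDivFree (fun w => (c / ν) • U (c • w)) ∧
      (∀ z, -((1 : ℝ) • (Δ (fun w => (c / ν) • U (c • w))) z) + (1 / 2 : ℝ) • ((c / ν) • U (c • z))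
        + (1 / 2 : ℝ) • fderiv ℝ (fun w => (c / ν) • U (c • w)) z z
        + (((2 * a)⁻¹ • B) ((c / ν) • U (c • z))
            - fderiv ℝ (fun w => (c / ν) • U (c • w)) z (((2 * a)⁻¹ • B) z))
        + convect (fun w => (c / ν) • U (c • w)) (fun w => (c / ν) • U (c • w)) z
        + gradient (fun w => (c / ν) ^ 2 * P (c • w)) z = 0) ∧
      (∀ z, fderiv ℝ (fun w => (c / ν) • U (c • w)) z = (2 * a)⁻¹ • fderiv ℝ U (c • z)) := by
  set c : ℝ := Real.sqrt (ν / (2 * a)) with hc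
  have hc0 : 0 < c := Real.sqrt_pos.2 (by positivity)
  have hc2 : c ^ 2 = ν / (2 * a) := Real.sq_sqrt (by positivity)
  have hkc : c / ν * c = (2 * a)⁻¹ := by
    rw [div_mul_eq_mul_div, ← sq, hc2]; field_simp
  have hP' : ContDiff ℝ ∞ P := contDiff_pressure_of_rotated hU hP heq
  refine ⟨c, hc0, ?_, ?_, ?_, ?_, ?_, ?_, ?_⟩
  · rw [div_pow, hc2]; field_simp
  · exact (hU.comp (contDiff_const_smul c)).const_smul (c / ν)
  · exact contDiff_const.mul (hP'.comp (contDiff_const_smul c))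
  · intro x
    rw [smul_apply, real_inner_smul_left, hB x, mul_zero]
  · intro z
    show VectorCalculus.divergence (fun w => (c / ν) • U (c • w)) z = 0
    rw [divergence_const_smul_comp_smul, hdiv (c • z), mul_zero]
  · intro z
    have hν1 : (1 : ℝ) * c = c / ν * ν := by field_simp
    have ha1 : (1 / 2 : ℝ) = c / ν * c * a := by rw [hkc]; field_simp
    have h := rotatedProfileSystem_dilate (B := B) hc0.ne' hν1 ha1 heq z
    rwa [hkc] at h
  · intro z
    rw [fderiv_const_smul_comp_smul' U (c / ν) c z, hkc]

/-! ### Axis normal form -/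

/-- **Axis normal form of the normalised rotated profile system.** Let `(Ū, P̄)` (`Ū, P̄ ∈ C^∞`,
`div Ū = 0`) solve the rotated Leray profile system with `ν = 1`, `a = ½` and a skew frame rate
`B'`. Then there are a linear isometry `L` of `ℝ³` and `α ∈ ℝ` (with `L B' L⁻¹ = αJ`,
`J = rotGen = e₃ × ·`; `α = 0`, `L = 1` if `B' = 0`) such that `V = L ∘ Ū ∘ L⁻¹`, `Q = P̄ ∘ L⁻¹`
are smooth, divergence free, and solve Pineau–Vicol's profile system (1.8a)
`α(JV − DV[Jy]) + ½V + ½DV[y] − ΔV + DV[V] + ∇Q = 0`; every term is `L`-covariant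
(`IsometryInvariance`) and `L(B'Ū) = αJV`, `L DŪ[B' L⁻¹y] = α DV[Jy]`.  Norms are kept:
`‖V(y)‖ = ‖Ū(L⁻¹y)‖`, `‖DŪ(x)‖ ≤ ‖DV(Lx)‖`. [cite: PineauVicol2026, (1.8a) (arXiv:2607.09619 p. 3)] -/
theorem rotatedProfileSystem_axisNormalForm {B' : (EuclideanSpace ℝ (Fin 3)) →L[ℝ] (EuclideanSpace ℝ (Fin 3))} {W : (EuclideanSpace ℝ (Fin 3)) → (EuclideanSpace ℝ (Fin 3))} {R : (EuclideanSpace ℝ (Fin 3)) → ℝ}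
    (hW : ContDiff ℝ ∞ W) (hR : ContDiff ℝ ∞ R) (hB' : ∀ x, ⟪B' x, x⟫ = 0)
    (hdiv : VectorCalculus.IsDivFree W)
    (heq : ∀ z, -((1 : ℝ) • (Δ W) z) + (1 / 2 : ℝ) • W z + (1 / 2 : ℝ) • fderiv ℝ W z z
      + (B' (W z) - fderiv ℝ W z (B' z)) + convect W W z + gradient R z = 0) :
    ∃ (L : (EuclideanSpace ℝ (Fin 3)) ≃ₗᵢ[ℝ] (EuclideanSpace ℝ (Fin 3))) (α : ℝ),
      ContDiff ℝ ∞ (fun y => L (W (L.symm y))) ∧ ContDiff ℝ ∞ (fun y => R (L.symm y)) ∧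
      VectorCalculus.IsDivFree (fun y => L (W (L.symm y))) ∧
      (∀ y, α • (rotGen (L (W (L.symm y))) - fderiv ℝ (fun y => L (W (L.symm y))) y (rotGen y))
        + (1 / 2 : ℝ) • L (W (L.symm y)) + (1 / 2 : ℝ) • fderiv ℝ (fun y => L (W (L.symm y))) y y
        - (Δ (fun y => L (W (L.symm y)))) y
        + fderiv ℝ (fun y => L (W (L.symm y))) y (L (W (L.symm y)))
        + gradient (fun y => R (L.symm y)) y = 0) ∧
      (∀ y, ‖L (W (L.symm y))‖ = ‖W (L.symm y)‖) ∧
      (∀ x, ‖fderiv ℝ W x‖ ≤ ‖fderiv ℝ (fun y => L (W (L.symm y))) (L x)‖) := by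
  -- the conjugating isometry and the rate: `L B' L⁻¹ = α J`
  obtain ⟨L, α, hLB⟩ : ∃ (L : (EuclideanSpace ℝ (Fin 3)) ≃ₗᵢ[ℝ] (EuclideanSpace ℝ (Fin 3))) (α : ℝ), ∀ y, L (B' (L.symm y)) = α • rotGen y := by
    by_cases hB0 : B' = 0
    · exact ⟨LinearIsometryEquiv.refl ℝ (EuclideanSpace ℝ (Fin 3)), 0, fun y => by simp [hB0]⟩
    · obtain ⟨L, α, -, h⟩ := exists_conj_eq_smul_rotGen hB' hB0
      exact ⟨L, α, h⟩
  -- the derivative of the conjugate field, applied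
  have hD : ∀ y v : (EuclideanSpace ℝ (Fin 3)), fderiv ℝ (fun z => L (W (L.symm z))) y v =
      L (fderiv ℝ W (L.symm y) (L.symm v)) := fun y v => by
    rw [fderiv_conj_linearIsometryEquiv]
    rfl
  refine ⟨L, α, ?_, ?_, hdiv.conj_linearIsometryEquiv L, ?_, fun y => L.norm_map _, ?_⟩
  · exact L.toContinuousLinearEquiv.contDiff.comp (hW.comp L.symm.toContinuousLinearEquiv.contDiff)
  · exact hR.comp L.symm.toContinuousLinearEquiv.contDiff
  · -- Pineau–Vicol's system at `y`, from the normalised system at `x = L⁻¹ y`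
    intro y
    obtain ⟨x, hx⟩ : ∃ x : (EuclideanSpace ℝ (Fin 3)), L.symm y = x := ⟨_, rfl⟩
    have h1 : L (B' (W x)) = α • rotGen (L (W x)) := by
      have h := hLB (L (W x))
      rwa [LinearIsometryEquiv.symm_apply_apply] at h
    have h2 : α • fderiv ℝ (fun z => L (W (L.symm z))) y (rotGen y) = L (fderiv ℝ W x (B' x)) := by
      rw [← ContinuousLinearMap.map_smul, ← hLB y, hD, LinearIsometryEquiv.symm_apply_apply, hx]
    have h3 : fderiv ℝ (fun z => L (W (L.symm z))) y y = L (fderiv ℝ W x x) := by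
      rw [hD, hx]
    have h4 : fderiv ℝ (fun z => L (W (L.symm z))) y (L (W x)) = L (fderiv ℝ W x (W x)) := by
      rw [hD, LinearIsometryEquiv.symm_apply_apply, hx]
    have h5 : (Δ (fun z => L (W (L.symm z)))) y = L ((Δ W) x) := by
      rw [laplacian_conj_linearIsometryEquiv, hx]
    have h6 : gradient (fun z => R (L.symm z)) y = L (gradient R x) := by
      rw [gradient_comp_linearIsometryEquiv_symm, hx]
    have key := congrArg L (heq x)
    simp only [one_smul, map_zero, map_add, map_sub, map_neg, LinearIsometryEquiv.map_smul,
      convect_apply] at key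
    rw [hx, h3, h4, h5, h6]
    linear_combination (norm := module) key - h1 - h2
  · -- `‖DŪ(x)‖ ≤ ‖DV(Lx)‖`: `DŪ(x) w = L⁻¹ (DV(Lx) (L w))`
    intro x
    refine ContinuousLinearMap.opNorm_le_bound _ (norm_nonneg _) fun w => ?_
    have e : fderiv ℝ W x w = L.symm (fderiv ℝ (fun z => L (W (L.symm z))) (L x) (L w)) := by
      rw [hD, LinearIsometryEquiv.symm_apply_apply, LinearIsometryEquiv.symm_apply_apply,
        LinearIsometryEquiv.symm_apply_apply]
    rw [e, LinearIsometryEquiv.norm_map]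
    exact (ContinuousLinearMap.le_opNorm _ _).trans (by rw [L.norm_map])

/-! ### The composite dictionary -/

/-- **From a rotated profile to a Pineau–Vicol profile.** Every smooth solution `(U, P)`
(`U ∈ C^∞`, `P ∈ C¹`, `div U = 0`) of the rotated Leray profile system with ANY `ν, a > 0` and ANY
skew frame rate `B` gives rise — by the normalisation `Ū(z) = U(cz)/√(2aν)`, `c = √(ν/(2a))`, and an
axis normal form `V = L ∘ Ū ∘ L⁻¹` — to a smooth divergence-free solution `(V, Q)` of
Pineau–Vicol's profile system (1.8a) with some rate `α`, such that amplitude and gradient are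
controlled: `sup |V| ≤ M/√(2aν)` whenever `sup |U| ≤ M`, and for every `y` there is `z` with
`‖DU(y)‖ ≤ 2a ‖DV(z)‖`. [cite: PineauVicol2026, (1.7)–(1.8a) (arXiv:2607.09619 p. 3)] -/
theorem exists_pvProfile_of_rotatedProfile {ν a : ℝ} (hν : 0 < ν) (ha : 0 < a)
    {B : (EuclideanSpace ℝ (Fin 3)) →L[ℝ] (EuclideanSpace ℝ (Fin 3))} {U : (EuclideanSpace ℝ (Fin 3)) → (EuclideanSpace ℝ (Fin 3))} {P : (EuclideanSpace ℝ (Fin 3)) → ℝ}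
    (hU : ContDiff ℝ ∞ U) (hP : ContDiff ℝ 1 P) (hB : ∀ x, ⟪B x, x⟫ = 0)
    (hdiv : VectorCalculus.IsDivFree U)
    (heq : ∀ y, -(ν • (Δ U) y) + a • U y + a • fderiv ℝ U y y + (B (U y) - fderiv ℝ U y (B y))
      + convect U U y + gradient P y = 0) :
    ∃ (α : ℝ) (V : (EuclideanSpace ℝ (Fin 3)) → (EuclideanSpace ℝ (Fin 3))) (Q : (EuclideanSpace ℝ (Fin 3)) → ℝ),
      ContDiff ℝ ∞ V ∧ ContDiff ℝ ∞ Q ∧ VectorCalculus.IsDivFree V ∧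
      (∀ y, α • (rotGen (V y) - fderiv ℝ V y (rotGen y)) + (1 / 2 : ℝ) • V y
        + (1 / 2 : ℝ) • fderiv ℝ V y y - (Δ V) y + fderiv ℝ V y (V y) + gradient Q y = 0) ∧
      (∀ M : ℝ, (∀ y, ‖U y‖ ≤ M) → ∀ y, ‖V y‖ ≤ M / Real.sqrt (2 * a * ν)) ∧
      (∀ y, ∃ z, ‖fderiv ℝ U y‖ ≤ 2 * a * ‖fderiv ℝ V z‖) := by
  obtain ⟨c, hc0, hk2, hW, hR, hB', hdivW, heqW, hDW⟩ :=
    rotatedProfileSystem_normalise hν ha hU hP hB hdiv heq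
  obtain ⟨L, α, hV, hQ, hdivV, heqV, hnormV, hDV⟩ :=
    rotatedProfileSystem_axisNormalForm hW hR hB' hdivW heqW
  refine ⟨α, fun y => L ((c / ν) • U (c • L.symm y)), fun y => (c / ν) ^ 2 * P (c • L.symm y),
    hV, hQ, hdivV, heqV, fun M hM y => ?_, fun y => ?_⟩
  · -- amplitude: `‖V y‖ = (c/ν) ‖U(c L⁻¹ y)‖ ≤ M/√(2aν)`
    have hkpos : 0 < c / ν := div_pos hc0 hν
    have hk : c / ν = (Real.sqrt (2 * a * ν))⁻¹ := by
      have h2 : 0 < 2 * a * ν := by positivity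
      rw [← Real.sqrt_inv, eq_comm, Real.sqrt_eq_iff_eq_sq (inv_nonneg.2 h2.le) hkpos.le, hk2]
    rw [hnormV y, norm_smul, Real.norm_of_nonneg hkpos.le, hk, div_eq_inv_mul]
    exact mul_le_mul_of_nonneg_left (hM _) (inv_nonneg.2 (Real.sqrt_nonneg _))
  · -- gradient: `DU(y) = 2a DŪ(c⁻¹ y)` and `‖DŪ(x)‖ ≤ ‖DV(Lx)‖`
    set x : (EuclideanSpace ℝ (Fin 3)) := c⁻¹ • y with hx
    have hcx : c • x = y := by rw [hx, smul_smul, mul_inv_cancel₀ hc0.ne', one_smul]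
    refine ⟨L x, ?_⟩
    have h1 : fderiv ℝ U y = (2 * a) • fderiv ℝ (fun w => (c / ν) • U (c • w)) x := by
      rw [hDW x, hcx, smul_smul, mul_inv_cancel₀ (by positivity), one_smul]
    rw [h1, norm_smul, Real.norm_of_nonneg (by positivity)]
    exact mul_le_mul_of_nonneg_left (hDV x) (by positivity)

end Summit.NavierStokesRegularity.NavierStokesRegularity.Theorems.CoriolisHead

end
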